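/-
Copyright (c) 2026 the pub-hodgecm-mathlib formalisation cell (harness21).  Prover seat hodgecm-mathlib-K2E1-p13 (g4), Track B ∕ K2-LIT, h413 = `stmt-HodgeConjecture-24833`,
R90-TF section S8 «ContSpec-n½», #2 chain (G side), deal S8-R38 (3) of R90-CS-plan (g2), row F6 of R90-C14-p02's `CENSUS-sock2-chain` (c): (L₃-i) — the TOP-POLE residue of the
`ψ∘det`-twisted spherical Borel Eisenstein family of `U(Φ₃)` is `c·(ψ∘det)`, and such `L²` classes lie in `⨆_ψ ℂ·[ψ∘det]` — the N = 3 twin of ★ `K2E1ChiEisensteinDetTwistU2` §5 +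
★ (B) `K2E1SelfDualResidueAtomMemCharLineCMTwo`, every input ★ (census `R90/S8/CENSUS-F6.K2E1-p13-g4.md`).
-/
import Summits.HodgeConjecture.HodgeConjecture.Theorems.K2E1ChiEisensteinDetTwistU2                 -- ★ (K2E1-p13 g3): the `det`-twist calculus, generic in `N` (§1–§4)
import Summits.HodgeConjecture.HodgeConjecture.Theorems.K2E1SphericalEisensteinL2ResidueCMThree      -- ★ `residueValue_eq_const_cm_three_of_ms` (R5 at `χ = 1`, top pole `z = 2`, (MS-2) form)
import Summits.HodgeConjecture.HodgeConjecture.Theorems.K2E1SelfDualResidueAtomMemCharLineCMTwo      -- ★ (B) p861962: §1 generic dictionary `mem_lineSubrep_inv_of_ae_eq` (any adelic datum)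
import Summits.HodgeConjecture.HodgeConjecture.Theorems.R90S8CharLineOfOneDim                        -- ★ `cm_exists_eq_cmDetChar_of_eq_antidiagonal_three` (every automorphic character of `U(Φ₃)(𝔸)` is `ψ∘det`)
import HarnessLib

/-!
# S8 #2 chain, F6 — `K2E1ChiEisensteinTopResidueCharLineU3`: (L₃-i) THE TOP-POLE RESIDUE OF THE `ψ∘det`-TWISTED SPHERICAL EISENSTEIN FAMILY OF `U(Φ₃)` IS `φ₀ r·(ψ∘det)`,
# AND AN `L²` CLASS OF THAT SHAPE LIES IN `⨆_ψ ℂ·[ψ∘det]` (the line summand of socket #2's closure target)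

Track B ∕ K2-LIT, crux h413 = `stmt-HodgeConjecture-24833`, route of record `HCCMUnconditional`; cell `hodgecm-mathlib`, R90-TF programme, section S8 «ContSpec-n½», socket #2
`sock_S8_res_classification` of `Lines/R90_S8_ResidualSpectrumU3B.lean` (ED. 4 :205), G-side letter chain F1–F6 (S8-R35 (2), S8-R37 (4), S8-R38 (3)).  THEOREMS ONLY (no `def`, no
`instance`, no `notation`, no named-fact hypothesis, no `sorry`; default heartbeats); lane `--supports stmt-HodgeConjecture-24833 --as helper` (count-neutral).  CLOSES NO SOCKET: it is
the (L) letter of F1 `R90S8ResGLeClosureOfLettersU3` for the LINE summand, in the same two currencies the H side used (★ `residue_detTwist_eq_const_mul_cm_two` + ★ (B)).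

THE MATHEMATICS ([Rogawski1990] §13.3 p. 202 «the residue of `E(φ·(χ∘det), s)` at the top pole is a multiple of `χ∘det`», §13.9 (i) p. 229; [MoeglinWaldspurger1995] IV.1.11;
[Langlands1976] §7; [Gelbart1975] §2.A).  On `G = U(Φ₃) = quasiSplit L⁺ L c 3` the continued spherical Borel Eisenstein family `Ẽ(z)` (E1 normalisation: Godement domain `2 < Re z`, top
pole `z = 2`) has residue the CONSTANT `φ₀ r` at the top pole (★ R5 `residueValue_eq_const_cm_three_of_ms`, `(z − 2)c(z) → r`).  An AUTOMORPHIC CHARACTER `Θ` of `G(𝔸)` — and every one is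
`ψ∘det` (★ `cm_exists_eq_cmDetChar_of_eq_antidiagonal_three`) — passes through every object of the Borel–Eisenstein calculus (★ `K2E1ChiEisensteinDetTwistU2` §1–§4, generic in `N`:
`E(f·Θ) = Θ·E(f)`, flat sections, pseudo-Eisenstein sums, constant terms (`Θ` kills `N(𝔸)` for `N ≥ 2`), truncation, and the letters of a continued family), so the continued family of
the twisted spherical section `φ₀·Θ` is `z ↦ Ẽ(z)·Θ` and ITS TOP-POLE RESIDUE IS `φ₀ r · Θ(g)` (§2: untwist any pole letter of `Ẽ·Θ` by `Θ(g)⁻¹`, apply ★ R5, re-twist — §1 re-proves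
the two pole-letter transport lemmas of ★ DetTwist §3 at a GENERAL pole `z₀`, theirs being pinned to `z₀ = 1`).  The `L²` END (§3): an `L²(G(L⁺)∖G(𝔸), μ)` class a.e. equal to
`x ↦ r·Θ((out x)⁻¹)` is `r • [Θ⁻¹]` (★ (B) §1, any adelic datum), `Θ⁻¹ = ψ′∘det` for an automorphic `ψ′` of `U(1)`, hence the class lies in the subtype-indexed lattice
`⨆_ψ (lineSubrep (cmDetChar L 3 ((StdForm.antidiagonal 3).over L) ψ.1 ψ.2 _) μ)` — the LINE summand of F1's closure target (S8-R37 (4)), N = 3 twin of ★ p862113's (L) lattice.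
HONEST SCOPE.  NOT here (census §3): (KF) K-finite NON-spherical sections at the top pole (the tree's continued-Eisenstein package is typed for constant `K`-profile; F1 carries `hTopKfin`
if it needs them); (L-AE)₃ the identification `f =ᵐ x ↦ Fp′((out x)⁻¹) 2` of a consumer's `L²` residue class with the pointwise residue — an INPUT of §3 exactly as on the H side
(supplied by the (IDENT)₃ ∕ D5′ twin); «lines are residual» is ★ #1 `cmDetChar_lineSubrep_le_cmResidualSubspaceR_three`, consumed by F1 directly.

* §1 (generic `quasiSplit F E c N`, any pole `z₀`): `pole_letter_twist_at`, `residue_twist_at`.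
* §2 (CM, `N = 3`): **`residue_detTwist_eq_const_mul_cm_three`** — `Res_{z=2} E(φ₀·Θ, z)(g) = φ₀ r · Θ(g)` for ANY pole letter of the twisted family; binders = ★ R5's VERBATIM.
* §3 (`L²` end at `quasiSplit L⁺ L c 3`): **`mem_iSup_lineSubrep_cmDetChar_three_of_ae_eq`**, **`mem_iSup_lineSubrep_cmDetChar_three_of_ae_eq_residue`**,
  `span_le_iSup_lineSubrep_cmDetChar_three_of_forall_ae_eq` (for an `At₃` defined as a span of top-pole residue classes).
HONEST LABEL: HC_CM is proved only modulo the 7 printed citations (2 remaining named inputs: hLiu418 = `stmt-HodgeConjecture-24832`, h413 = `stmt-HodgeConjecture-24833`) until rung 0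
closes; REL ≠ ★ ≠ BUILT; this file asserts no named fact and closes no socket; count-neutral.

## References
* [Rogawski1990] J. D. Rogawski, *Automorphic Representations of Unitary Groups in Three Variables* (1990), §13.3 p. 202, §13.9 (i) p. 229.
* [MoeglinWaldspurger1995] C. Mœglin, J.-L. Waldspurger, *Spectral Decomposition and Eisenstein Series* (1995), II.1.5, IV.1.11.
* [Langlands1976] R. P. Langlands, *On the Functional Equations Satisfied by Eisenstein Series*, LNM 544 (1976), §7.
* [Gelbart1975] S. Gelbart, *Automorphic forms on adele groups* (1975), §2.A (character lines in `L²`).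
* [GelbartRogawski1991] S. Gelbart, J. Rogawski, *L-functions and Fourier–Jacobi coefficients for the unitary group U(3)*, Invent. Math. 105 (1991), §3.1 Remark p. 457.
-/

set_option autoImplicit false
set_option linter.dupNamespace false  -- the mandated namespace repeats `HodgeConjecture.HodgeConjecture`

noncomputable section

open MeasureTheory Measure NumberField IsDedekindDomain Set Filter Topology Metric
open scoped ENNReal NNReal
open Literature.NumberTheory.Automorphic Literature.NumberTheory.Automorphic.UnitaryGroup AdelicGroupData
open Literature.NumberTheory.Automorphic.Arthur2013.Leaves.TECR
open Summit.HodgeConjecture.HodgeConjecture.Cruxes.H413.K2E1BorelEisensteinU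
open Summit.HodgeConjecture.HodgeConjecture.Cruxes.H413.K2E1SphericalEisensteinL2ResidueCMThree (residueValue_eq_const_cm_three_of_ms)
open Summit.HodgeConjecture.HodgeConjecture.Cruxes.H413.K2E1SelfDualResidueAtomMemCharLineCMTwo (mem_lineSubrep_inv_of_ae_eq)
open Summit.HodgeConjecture.HodgeConjecture.R90.S8 (cm_exists_eq_cmDetChar_of_eq_antidiagonal_three)

namespace Summit.HodgeConjecture.HodgeConjecture.Cruxes.H413.K2E1ChiEisensteinTopResidueCharLineU3

/-! ## §1 Pole-letter transport under a pointwise twist, at a general pole `z₀` (★ DetTwist §3 (F) is pinned to `z₀ = 1`) -/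

section Letters

variable {F E : Type} [Field F] [NumberField F] [Field E] [NumberField E] [Algebra F E] {c : E ≃ₐ[F] E} {N : ℕ}

/-- (F at `z₀`) THE POLE LETTER passes to the twist: if `Fp g` is analytic at `z₀` and agrees with `(z−z₀)Ẽ(z)(g)` on a punctured neighbourhood, then `z ↦ Fp g z · θ(g)` does the same
for `Ẽ·θ`.  ★ `pole_letter_twist` at a general pole. [cite: MoeglinWaldspurger1995, IV.1.11] -/
theorem pole_letter_twist_at (z₀ : ℂ) (Ec : ℂ → (quasiSplit F E c N).Adelic → ℂ) (Fp : (quasiSplit F E c N).Adelic → ℂ → ℂ) (hF : ∀ g, AnalyticAt ℂ (Fp g) z₀)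
    (hFE : ∀ g, Fp g =ᶠ[𝓝[≠] z₀] fun z => (z - z₀) * Ec z g) (θ : (quasiSplit F E c N).Adelic → ℂ) :
    (∀ g, AnalyticAt ℂ (fun z => Fp g z * θ g) z₀) ∧ ∀ g, (fun z => Fp g z * θ g) =ᶠ[𝓝[≠] z₀] fun z => (z - z₀) * (Ec z g * θ g) := by
  refine ⟨fun g => (hF g).mul analyticAt_const, fun g => ?_⟩
  filter_upwards [hFE g] with z hz
  rw [hz, mul_assoc]

/-- **THE RESIDUE VALUE OF THE TWIST IS THE TWISTED RESIDUE VALUE, at a general pole `z₀`**: for ANY pole letter `(Fp', hF', hFE')` of `Ẽ·θ` and any pole letter `(Fp, hF, hFE)` of `Ẽ`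
at `z₀`, `Fp' g z₀ = Fp g z₀ · θ(g)` (limits along `𝓝[≠] z₀` are unique).  ★ `residue_twist` at a general pole. [cite: MoeglinWaldspurger1995, IV.1.11] -/
theorem residue_twist_at (z₀ : ℂ) (Ec : ℂ → (quasiSplit F E c N).Adelic → ℂ) (Fp : (quasiSplit F E c N).Adelic → ℂ → ℂ) (hF : ∀ g, AnalyticAt ℂ (Fp g) z₀)
    (hFE : ∀ g, Fp g =ᶠ[𝓝[≠] z₀] fun z => (z - z₀) * Ec z g) (θ : (quasiSplit F E c N).Adelic → ℂ)
    (Fp' : (quasiSplit F E c N).Adelic → ℂ → ℂ) (hF' : ∀ g, AnalyticAt ℂ (Fp' g) z₀) (hFE' : ∀ g, Fp' g =ᶠ[𝓝[≠] z₀] fun z => (z - z₀) * (Ec z g * θ g))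
    (g : (quasiSplit F E c N).Adelic) : Fp' g z₀ = Fp g z₀ * θ g := by
  have h1 : Tendsto (Fp' g) (𝓝[≠] z₀) (𝓝 (Fp' g z₀)) := tendsto_nhdsWithin_of_tendsto_nhds (hF' g).continuousAt.tendsto
  have h2 : Tendsto (fun z => Fp g z * θ g) (𝓝[≠] z₀) (𝓝 (Fp g z₀ * θ g)) :=
    (tendsto_nhdsWithin_of_tendsto_nhds (hF g).continuousAt.tendsto).mul_const _
  have heq : Fp' g =ᶠ[𝓝[≠] z₀] fun z => Fp g z * θ g := by
    filter_upwards [hFE' g, hFE g] with z hz hz'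
    rw [hz, hz', mul_assoc]
  exact tendsto_nhds_unique (h1.congr' heq) h2

end Letters

/-! ## §2 CM, `N = 3`: the residue of the `det`-twisted spherical family at the top pole `z = 2` is `φ₀ r · Θ` -/

section CM

variable (L : Type) [Field L] [NumberField L] [IsCMField L]
variable [MeasurableSpace (quasiSplit (↥(maximalRealSubfield L)) L (IsCMField.complexConj L) 3).Adelic] [BorelSpace (quasiSplit (↥(maximalRealSubfield L)) L (IsCMField.complexConj L) 3).Adelic]

-- the statement carries ★ `residueValue_eq_const_cm_three_of_ms`'s letter package verbatim (≈ 3 kB of binders); same class as the ★ N = 2 template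
/-- **R5 FOR A `det`-TWISTED SPHERICAL SECTION ON `U(Φ₃)`: `Res_{z=2} E(φ₀·Θ, z)(g) = φ₀ r · Θ(g)`.**  Binders = ★ `residueValue_eq_const_cm_three_of_ms`'s VERBATIM (the continued
spherical family `Ẽ` with its letters (E1)–(E4), (E2-bd), `G(F)`-invariance, the constant-term shape `φ₀(H^z + c(z)H^{2−z})` with `(z−2)c(z) → r`, the truncated `L²` family and the
Maass–Selberg bound (MS-2)) MINUS its pole letter `(Fp, hF, hFE)`, PLUS an automorphic character `Θ` of `U(Φ₃)(𝔸)` and ANY pole letter `(Fp', hF', hFE')` at `z = 2` of the TWISTED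
family `z ↦ Ẽ(z)·Θ` — which by ★ `eq_eisensteinSeriesU_flatSectionU_twist` IS the continued Eisenstein family of the twisted section `φ₀·Θ`, with every letter of the package (★ DetTwist
§3–§4 at `N = 3`).  Proof: untwist the pole letter (`Θ(g) ≠ 0`), apply ★ R5 at `χ = 1`, re-twist (§1).  N = 3 twin of ★ `residue_detTwist_eq_const_mul_cm_two`.
[cite: Rogawski1990, §13.3 p. 202] [cite: MoeglinWaldspurger1995, IV.1.11] [cite: Langlands1976, §7] -/
theorem residue_detTwist_eq_const_mul_cm_three
    (μ : Measure (quasiSplit (↥(maximalRealSubfield L)) L (IsCMField.complexConj L) 3).automorphicQuotient) [(quasiSplit (↥(maximalRealSubfield L)) L (IsCMField.complexConj L) 3).IsAutomorphicMeasure μ]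
    (ν : Measure ↥(adelicUnipotent (↥(maximalRealSubfield L)) L (IsCMField.complexConj L) 3)) [ν.IsHaarMeasure]
    {𝓕 : Set ↥(adelicUnipotent (↥(maximalRealSubfield L)) L (IsCMField.complexConj L) 3)}
    (h𝓕N : IsFundamentalDomain ↥(rationalUnipotent (↥(maximalRealSubfield L)) L (IsCMField.complexConj L) 3) 𝓕 ν) (h𝓕c : IsCompact (closure 𝓕))
    (φ₀ : ℂ) {T : ℝ≥0} (hT : 1 ≤ T)
    (Ec : ℂ → (quasiSplit (↥(maximalRealSubfield L)) L (IsCMField.complexConj L) 3).Adelic → ℂ) {D : Set ℂ} (hDo : IsOpen D) (hDc : IsPreconnected D)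
    {σ₀ : ℝ} (hσ₀ : 2 < σ₀) (hσD : ∀ᶠ z in 𝓝 ((σ₀ : ℝ) : ℂ), z ∈ D) {ρ : ℝ} (hρ : 0 < ρ) (hρD : ∀ z : ℂ, z ≠ 2 → dist z 2 < ρ → z ∈ D)
    (hEd : ∀ g, DifferentiableOn ℂ (fun z => Ec z g) D) (hE4 : ∀ z ∈ D, Continuous (Ec z))
    (hEbd : ∀ z₀ ∈ D, ∀ K : Set (quasiSplit (↥(maximalRealSubfield L)) L (IsCMField.complexConj L) 3).Adelic, IsCompact K → ∃ V ∈ 𝓝 z₀, ∃ M : ℝ, ∀ z ∈ V, ∀ g ∈ K, ‖Ec z g‖ ≤ M)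
    (hEcinv : ∀ z ∈ D, ∀ (γ : (quasiSplit (↥(maximalRealSubfield L)) L (IsCMField.complexConj L) 3).arithmeticSubgroup) (x : (quasiSplit (↥(maximalRealSubfield L)) L (IsCMField.complexConj L) 3).Adelic),
      Ec z ((γ : (quasiSplit (↥(maximalRealSubfield L)) L (IsCMField.complexConj L) 3).Adelic) * x) = Ec z x)
    (hE2 : ∀ z ∈ D, 2 < z.re → Ec z = eisensteinSeriesU (flatSectionU (fun _ : (quasiSplit (↥(maximalRealSubfield L)) L (IsCMField.complexConj L) 3).Adelic => φ₀) z))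
    {cc : ℂ → ℂ} {r : ℂ} (hcres : Tendsto (fun z : ℂ => (z - 2) * cc z) (𝓝[≠] 2) (𝓝 r))
    (hE3 : ∀ z ∈ D, ∀ g : (quasiSplit (↥(maximalRealSubfield L)) L (IsCMField.complexConj L) 3).Adelic,
      borelConstantTerm ν 𝓕 (Ec z) g = φ₀ * ((((borelHeight g : ℝ≥0) : ℝ) : ℂ) ^ z + cc z * (((borelHeight g : ℝ≥0) : ℝ) : ℂ) ^ (2 - z)))
    (Fam : ℂ → (quasiSplit (↥(maximalRealSubfield L)) L (IsCMField.complexConj L) 3).L2 μ) (hFd : DifferentiableOn ℂ Fam D)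
    (hFam : ∀ z ∈ D, ((Fam z : (quasiSplit (↥(maximalRealSubfield L)) L (IsCMField.complexConj L) 3).L2 μ) : (quasiSplit (↥(maximalRealSubfield L)) L (IsCMField.complexConj L) 3).automorphicQuotient → ℂ) =ᵐ[μ]
      (quasiSplit (↥(maximalRealSubfield L)) L (IsCMField.complexConj L) 3).quotFun (truncation ν 𝓕 T (Ec z)))
    (hMS2 : ∃ C : ℝ, ∀ᶠ z in 𝓝[≠] (2 : ℂ), ‖(z - 2) • Fam z‖ ≤ C)
    (Θ : (quasiSplit (↥(maximalRealSubfield L)) L (IsCMField.complexConj L) 3).AutomorphicCharacter)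
    (Fp' : (quasiSplit (↥(maximalRealSubfield L)) L (IsCMField.complexConj L) 3).Adelic → ℂ → ℂ) (hF' : ∀ g, AnalyticAt ℂ (Fp' g) 2)
    (hFE' : ∀ g, Fp' g =ᶠ[𝓝[≠] 2] fun z => (z - 2) * (Ec z g * ((Θ g : ℂˣ) : ℂ))) :
    ∀ g : (quasiSplit (↥(maximalRealSubfield L)) L (IsCMField.complexConj L) 3).Adelic, Fp' g 2 = φ₀ * r * ((Θ g : ℂˣ) : ℂ) := by
  -- untwist the pole letter: `Fp g z := Fp' g z · Θ(g)⁻¹` is a pole letter for `Ẽ` at `2`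
  have hΘ0 : ∀ g : (quasiSplit (↥(maximalRealSubfield L)) L (IsCMField.complexConj L) 3).Adelic, ((Θ g : ℂˣ) : ℂ) ≠ 0 := fun g => (Θ g).ne_zero
  have hpole := pole_letter_twist_at 2 (fun z g => Ec z g * ((Θ g : ℂˣ) : ℂ)) Fp' hF' hFE' (fun g => (((Θ g : ℂˣ) : ℂ))⁻¹)
  have hFE : ∀ g, (fun z => Fp' g z * (((Θ g : ℂˣ) : ℂ))⁻¹) =ᶠ[𝓝[≠] 2] fun z => (z - 2) * Ec z g := fun g => by
    filter_upwards [hpole.2 g] with z hz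
    rw [hz, mul_assoc, mul_inv_cancel₀ (hΘ0 g), mul_one]
  have hsph := residueValue_eq_const_cm_three_of_ms L μ ν h𝓕N h𝓕c φ₀ hT Ec hDo hDc hσ₀ hσD hρ hρD hEd hE4 hEbd hEcinv hE2 hcres hE3
    (fun g z => Fp' g z * (((Θ g : ℂˣ) : ℂ))⁻¹) hpole.1 hFE Fam hFd hFam hMS2
  intro g
  rw [← hsph g, mul_assoc, inv_mul_cancel₀ (hΘ0 g), mul_one]

end CM

/-! ## §3 The `L²` end at `quasiSplit L⁺ L c 3`: a class a.e. equal to `x ↦ r·Θ((out x)⁻¹)` lies in `⨆_ψ ℂ·[ψ∘det]` (the line summand of F1's closure target) -/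

section L2

variable (L : Type) [Field L] [NumberField L] [IsCMField L]
  (μ : Measure (quasiSplit (↥(maximalRealSubfield L)) L (IsCMField.complexConj L) 3).automorphicQuotient)
  [(quasiSplit (↥(maximalRealSubfield L)) L (IsCMField.complexConj L) 3).IsAutomorphicMeasure μ]

/-- **AN `L²` CLASS A.E. EQUAL TO `x ↦ r·Θ((out x)⁻¹)`, `Θ` ANY AUTOMORPHIC CHARACTER OF `U(Φ₃)(𝔸)`, LIES IN `⨆_ψ ℂ·[ψ∘det]`** (subtype-indexed lattice of F1's target, S8-R37 (4)):
`f = r • [Θ⁻¹] ∈ Θ⁻¹.lineSubrep μ` (★ (B) §1, any adelic datum) and `Θ⁻¹ = cmDetChar L 3 ((antidiagonal 3).over L) ψ′ _ _` for an automorphic `ψ′` of `U(1)`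
(★ `cm_exists_eq_cmDetChar_of_eq_antidiagonal_three`).  N = 3 twin of ★ `mem_iSup_charLine₂_of_ae_eq`. [cite: Rogawski1990, §13.3 p. 202] [cite: Gelbart1975, §2.A] -/
theorem mem_iSup_lineSubrep_cmDetChar_three_of_ae_eq
    (Θ : (quasiSplit (↥(maximalRealSubfield L)) L (IsCMField.complexConj L) 3).AutomorphicCharacter) (r : ℂ)
    {f : (quasiSplit (↥(maximalRealSubfield L)) L (IsCMField.complexConj L) 3).L2 μ}
    (hf : (f : (quasiSplit (↥(maximalRealSubfield L)) L (IsCMField.complexConj L) 3).automorphicQuotient → ℂ) =ᵐ[μ]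
      fun x => r * ((Θ (Quotient.out (x : (quasiSplit (↥(maximalRealSubfield L)) L (IsCMField.complexConj L) 3).Adelic ⧸ (quasiSplit (↥(maximalRealSubfield L)) L (IsCMField.complexConj L) 3).quotientSubgroup))⁻¹ : ℂˣ) : ℂ)) :
    f ∈ ⨆ ψ : {ψ : ↥(TorusDict.torus (IsCMField.complexConj L)) →ₜ* ℂˣ // TorusDict.IsAutomorphic (IsCMField.complexConj L) ψ},
        (AdelicGroupData.AutomorphicCharacter.lineSubrep (𝒢 := (quasiSplit (↥(maximalRealSubfield L)) L (IsCMField.complexConj L) 3))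
          (cmDetChar L 3 ((StdForm.antidiagonal 3).over L) ψ.1 ψ.2 ((Matrix.isUnit_iff_isUnit_det _).mp (StdForm.isUnit_over (StdForm.antidiagonal 3) L)).ne_zero) μ).toSubmodule := by
  obtain ⟨θ, hθ, hΘθ⟩ := cm_exists_eq_cmDetChar_of_eq_antidiagonal_three L ((StdForm.antidiagonal 3).over L) rfl
    ((Matrix.isUnit_iff_isUnit_det _).mp (StdForm.isUnit_over (StdForm.antidiagonal 3) L)).ne_zero Θ⁻¹
  have hmem : f ∈ (AdelicGroupData.AutomorphicCharacter.lineSubrep (𝒢 := (quasiSplit (↥(maximalRealSubfield L)) L (IsCMField.complexConj L) 3))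
      (cmDetChar L 3 ((StdForm.antidiagonal 3).over L) θ hθ ((Matrix.isUnit_iff_isUnit_det _).mp (StdForm.isUnit_over (StdForm.antidiagonal 3) L)).ne_zero) μ).toSubmodule := by
    rw [hΘθ]
    exact mem_lineSubrep_inv_of_ae_eq Θ μ r hf
  exact Submodule.mem_iSup_of_mem ⟨θ, hθ⟩ hmem

/-- **THE POINTWISE-RESIDUE FORM at `U(Φ₃)`**: from §2's conclusion shape `hres : ∀ g, F g = r * Θ g` (`F = Fp′ · 2`, `r = φ₀ r₀`, `Θ = ψ∘det`) and the (L-AE)₃-type identification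
`f =ᵐ x ↦ F((out x)⁻¹)` of an `L²` residue class, `f ∈ ⨆_ψ ℂ·[ψ∘det]`. [cite: MoeglinWaldspurger1995, IV.1.11] [cite: Rogawski1990, §13.3 p. 202] -/
theorem mem_iSup_lineSubrep_cmDetChar_three_of_ae_eq_residue
    (Θ : (quasiSplit (↥(maximalRealSubfield L)) L (IsCMField.complexConj L) 3).AutomorphicCharacter)
    {F : (quasiSplit (↥(maximalRealSubfield L)) L (IsCMField.complexConj L) 3).Adelic → ℂ} {r : ℂ} (hres : ∀ g, F g = r * ((Θ g : ℂˣ) : ℂ))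
    {f : (quasiSplit (↥(maximalRealSubfield L)) L (IsCMField.complexConj L) 3).L2 μ}
    (hf : (f : (quasiSplit (↥(maximalRealSubfield L)) L (IsCMField.complexConj L) 3).automorphicQuotient → ℂ) =ᵐ[μ]
      fun x => F (Quotient.out (x : (quasiSplit (↥(maximalRealSubfield L)) L (IsCMField.complexConj L) 3).Adelic ⧸ (quasiSplit (↥(maximalRealSubfield L)) L (IsCMField.complexConj L) 3).quotientSubgroup))⁻¹) :
    f ∈ ⨆ ψ : {ψ : ↥(TorusDict.torus (IsCMField.complexConj L)) →ₜ* ℂˣ // TorusDict.IsAutomorphic (IsCMField.complexConj L) ψ},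
        (AdelicGroupData.AutomorphicCharacter.lineSubrep (𝒢 := (quasiSplit (↥(maximalRealSubfield L)) L (IsCMField.complexConj L) 3))
          (cmDetChar L 3 ((StdForm.antidiagonal 3).over L) ψ.1 ψ.2 ((Matrix.isUnit_iff_isUnit_det _).mp (StdForm.isUnit_over (StdForm.antidiagonal 3) L)).ne_zero) μ).toSubmodule :=
  mem_iSup_lineSubrep_cmDetChar_three_of_ae_eq L μ Θ r (hf.trans (Filter.Eventually.of_forall fun _ => hres _))

/-- **SPAN FORM** (for an `At₃` defined as the span of top-pole residue classes): if every member of a set `S ⊆ L²` is a.e. `x ↦ r_f·Θ_f((out x)⁻¹)` for some automorphic character `Θ_f`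
and scalar `r_f`, then `span S ≤ ⨆_ψ ℂ·[ψ∘det]`. [cite: Rogawski1990, §13.3 p. 202] [cite: MoeglinWaldspurger1995, IV.1.11] -/
theorem span_le_iSup_lineSubrep_cmDetChar_three_of_forall_ae_eq
    (S : Set ((quasiSplit (↥(maximalRealSubfield L)) L (IsCMField.complexConj L) 3).L2 μ))
    (hS : ∀ f ∈ S, ∃ (Θ : (quasiSplit (↥(maximalRealSubfield L)) L (IsCMField.complexConj L) 3).AutomorphicCharacter) (r : ℂ),
      (f : (quasiSplit (↥(maximalRealSubfield L)) L (IsCMField.complexConj L) 3).automorphicQuotient → ℂ) =ᵐ[μ]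
        fun x => r * ((Θ (Quotient.out (x : (quasiSplit (↥(maximalRealSubfield L)) L (IsCMField.complexConj L) 3).Adelic ⧸ (quasiSplit (↥(maximalRealSubfield L)) L (IsCMField.complexConj L) 3).quotientSubgroup))⁻¹ : ℂˣ) : ℂ)) :
    Submodule.span ℂ S ≤ ⨆ ψ : {ψ : ↥(TorusDict.torus (IsCMField.complexConj L)) →ₜ* ℂˣ // TorusDict.IsAutomorphic (IsCMField.complexConj L) ψ},
        (AdelicGroupData.AutomorphicCharacter.lineSubrep (𝒢 := (quasiSplit (↥(maximalRealSubfield L)) L (IsCMField.complexConj L) 3))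
          (cmDetChar L 3 ((StdForm.antidiagonal 3).over L) ψ.1 ψ.2 ((Matrix.isUnit_iff_isUnit_det _).mp (StdForm.isUnit_over (StdForm.antidiagonal 3) L)).ne_zero) μ).toSubmodule :=
  Submodule.span_le.2 fun f hf => by
    obtain ⟨Θ, r, h⟩ := hS f hf
    exact mem_iSup_lineSubrep_cmDetChar_three_of_ae_eq L μ Θ r h

end L2

end Summit.HodgeConjecture.HodgeConjecture.Cruxes.H413.K2E1ChiEisensteinTopResidueCharLineU3

end
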